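import Summits.CriticalPhenomena.PercolationContinuityZ3.Theorems.SahiBoxTP2BooleanSpins
import Literature.Combinatorics.Sahi2008.UnderlyingIndependents
import Literature.Combinatorics.Sahi2008.UniformCube

/-!
# Sahi's conjecture `C_n` ⟺ every box-TP₂ law on `{0,1}^ℕ` is Sahi-positive of order `n`

Support file of the Sahi cell (`prim-sahi`, typer seat, generation 12; `--supports stmt-CriticalPhenomena-4575`).
The two-valued counterpart of `sahiConjecture_iff_forall_isBoxTP2_hilbert` (`SahiBoxTP2HilbertPositivity.lean`).

* `isBoxTP2_iff_fkg_marginals` — for a probability measure on `{0,1}^ℕ`: box-TP₂ ⟺ the cylinder probabilities of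
  every initial segment satisfy the FKG lattice condition (⇐ is `isBoxTP2_of_fkg_marginals`; ⇒: singletons are boxes).
* `IsBoxTP2.map_finExtend_bot` — a box-TP₂ law on a finite product `Fin d → X` extended by `⊥` is box-TP₂ on
  `ℕ → X` (generation 12's `IsBoxTP2.map_finExtend_zero` for a general bounded lattice `X`).
* `sahiPositive_coinWeight_of_spins` — Sahi positivity of all box-TP₂ laws on `{0,1}^ℕ` gives Sahi positivity of every
  non-degenerate coin-tossing weight on `{0,1}^m` (the padded product law is box-TP₂; `msahiE_weightMeasure`), hence
  of every FKG weight on every finite distributive lattice (Kahn's "FKG measures are FUI",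
  `SahiPositive.of_isFKGMeasure_of_forall_coinWeight`):
* **`sahiConjecture_iff_forall_isBoxTP2_spins (n) : SahiConjecture n ↔` every box-TP₂ probability measure on
  `ℕ → Bool` is Sahi-positive of order `n` for all measurable nonnegative monotone families**, and the same with the
  FKG-lattice-cylinder hypothesis (`sahiConjecture_iff_forall_fkg_marginals`).

HONEST FRAMING (cell rule): both sides are OPEN for `n ≥ 3`; this is an equivalence of formulations.  No sorries, no new
axioms.
-/

noncomputable section

namespace Summit.CriticalPhenomena.PercolationContinuityZ3.Theorems.SahiBoxTP2

open MeasureTheory ProbabilityTheory Set Filter Topology Function Literature.Combinatorics.Sahi2008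
open scoped ENNReal unitInterval

/-! ### Boxes of `{0,1}^ℕ` are measurable; box-TP₂ ⟺ FKG-lattice cylinders -/

section Cylinders

/-- Boxes of `ℕ → Bool` are measurable (countable intersections of finite-dimensional cylinders). [folklore] -/
theorem measurableSet_Icc_spins (a b : ℕ → Bool) : MeasurableSet (Icc a b) := by
  rw [Icc_eq_iInter_finRestrict]
  exact MeasurableSet.iInter fun d => ((Set.toFinite _).measurableSet).preimage (measurable_finRestrict d)

/-- **Box-TP₂ on `{0,1}^ℕ` ⟺ FKG-lattice cylinder probabilities on every initial segment.** [this work] -/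
theorem isBoxTP2_iff_fkg_marginals (μ : Measure (ℕ → Bool)) [IsFiniteMeasure μ] :
    IsBoxTP2 μ ↔ ∀ (d : ℕ) (x y : Fin d → Bool),
      μ.real {u | finRestrict d u = x} * μ.real {u | finRestrict d u = y} ≤
        μ.real {u | finRestrict d u = x ⊓ y} * μ.real {u | finRestrict d u = x ⊔ y} := by
  refine ⟨fun hμ d x y => ?_, isBoxTP2_of_fkg_marginals μ⟩
  have hIcc : ∀ (a b : Fin d → Bool), MeasurableSet (Icc a b) := fun a b => (Set.toFinite _).measurableSet
  have hd := hμ.map_finRestrict d hIcc x x y y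
  simp only [Icc_self, Measure.map_apply (measurable_finRestrict d) (measurableSet_singleton _)] at hd
  have e : ∀ z : Fin d → Bool, μ.real {u | finRestrict d u = z} = (μ (finRestrict d ⁻¹' {z})).toReal := fun z => rfl
  rw [e, e, e, e, ← ENNReal.toReal_mul, ← ENNReal.toReal_mul]
  exact ENNReal.toReal_mono (ENNReal.mul_ne_top (measure_ne_top μ _) (measure_ne_top μ _)) hd

end Cylinders

/-! ### Padding a finite product by `⊥` -/

section Extend

variable {X : Type*} [Lattice X] [OrderBot X] {d : ℕ}

/-- Extension by `⊥`, as a measurable map `(Fin d → X) → (ℕ → X)`. [folklore] -/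
theorem measurable_finExtend_bot [MeasurableSpace X] (d : ℕ) : Measurable fun x : Fin d → X => finExtend d x (⊥ : X) :=
  measurable_pi_lambda _ fun i => by
    by_cases hi : i < d
    · simp only [finExtend, dif_pos hi]; exact measurable_pi_apply _
    · simp only [finExtend, dif_neg hi]; exact measurable_const

/-- A box `[a,b]` of `ℕ → X` with `a_i = ⊥` for `i ≥ d` pulls back along the extension to the box `[a|_d, b|_d]`.
[folklore] -/
theorem finExtend_bot_preimage_Icc_of_forall {a : ℕ → X} (b : ℕ → X) (hP : ∀ i, d ≤ i → a i = ⊥) :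
    (fun x : Fin d → X => finExtend d x (⊥ : X)) ⁻¹' Icc a b = Icc (finRestrict d a) (finRestrict d b) := by
  ext x
  simp only [mem_preimage, mem_Icc, Pi.le_def, finRestrict_apply]
  constructor
  · rintro ⟨h1, h2⟩
    refine ⟨fun i => ?_, fun i => ?_⟩
    · have := h1 i; rwa [finExtend_of_lt x ⊥ i.2] at this
    · have := h2 i; rwa [finExtend_of_lt x ⊥ i.2] at this
  · rintro ⟨h1, h2⟩
    refine ⟨fun i => ?_, fun i => ?_⟩
    · by_cases hi : i < d
      · rw [finExtend_of_lt x ⊥ hi]; exact h1 ⟨i, hi⟩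
      · rw [finExtend_of_le x ⊥ (not_lt.1 hi), hP i (not_lt.1 hi)]
    · by_cases hi : i < d
      · rw [finExtend_of_lt x ⊥ hi]; exact h2 ⟨i, hi⟩
      · rw [finExtend_of_le x ⊥ (not_lt.1 hi)]; exact bot_le

/-- … and a box with some `a_i ≠ ⊥`, `i ≥ d`, pulls back to `∅`. [folklore] -/
theorem finExtend_bot_preimage_Icc_of_not {a : ℕ → X} (b : ℕ → X) (hP : ¬ ∀ i, d ≤ i → a i = ⊥) :
    (fun x : Fin d → X => finExtend d x (⊥ : X)) ⁻¹' Icc a b = ∅ := by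
  refine Set.eq_empty_of_forall_notMem fun x hx => hP fun i hi => ?_
  have h1 : a i ≤ finExtend d x ⊥ i := hx.1 i
  rw [finExtend_of_le x ⊥ hi] at h1
  exact le_antisymm h1 bot_le

/-- **A box-TP₂ law on `Fin d → X`, extended by `⊥`, is box-TP₂ on `ℕ → X`.** [this work] -/
theorem IsBoxTP2.map_finExtend_bot [MeasurableSpace X] {ν : Measure (Fin d → X)} (hν : IsBoxTP2 ν)
    (hIcc : ∀ a b : ℕ → X, MeasurableSet (Icc a b)) :
    IsBoxTP2 (ν.map fun x : Fin d → X => finExtend d x (⊥ : X)) := by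
  intro a b a' b'
  simp only [Measure.map_apply (measurable_finExtend_bot d) (hIcc _ _)]
  by_cases hP : ∀ i, d ≤ i → a i = ⊥
  · by_cases hP' : ∀ i, d ≤ i → a' i = ⊥
    · have hPi : ∀ i, d ≤ i → (a ⊓ a') i = ⊥ := fun i hi => by
        rw [Pi.inf_apply, hP i hi, hP' i hi, inf_idem]
      have hPs : ∀ i, d ≤ i → (a ⊔ a') i = ⊥ := fun i hi => by
        rw [Pi.sup_apply, hP i hi, hP' i hi, sup_idem]
      rw [finExtend_bot_preimage_Icc_of_forall b hP, finExtend_bot_preimage_Icc_of_forall b' hP',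
        finExtend_bot_preimage_Icc_of_forall _ hPi, finExtend_bot_preimage_Icc_of_forall _ hPs]
      exact hν (finRestrict d a) (finRestrict d b) (finRestrict d a') (finRestrict d b')
    · rw [finExtend_bot_preimage_Icc_of_not b' hP', measure_empty, mul_zero]; exact zero_le
  · rw [finExtend_bot_preimage_Icc_of_not b hP, measure_empty, zero_mul]; exact zero_le

end Extend

/-! ### From box-TP₂ laws on `{0,1}^ℕ` back to coin tossing on `{0,1}^m` -/

section Coins

variable {α : Type*} [Fintype α] [MeasurableSpace α] [MeasurableSingletonClass α]

/-- The point masses of `Σ_a w(a)·δ_a`. [folklore] -/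
theorem weightMeasure_real_singleton_eq {w : α → ℝ} (hw : ∀ a, 0 ≤ w a) (a : α) :
    (weightMeasure w).real {a} = w a := by
  classical
  rw [measureReal_def, weightMeasure, Measure.coe_finsetSum, Finset.sum_apply]
  simp only [Measure.coe_smul, Pi.smul_apply, Measure.dirac_apply' _ (measurableSet_singleton a),
    Set.indicator_apply, Set.mem_singleton_iff, Pi.one_apply, smul_eq_mul, mul_ite, mul_one, mul_zero,
    Finset.sum_ite_eq', Finset.mem_univ, if_true]
  exact ENNReal.toReal_ofReal (hw a)

/-- `Σ_a w(a)·δ_a` is a probability measure for a probability weight. [folklore] -/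
theorem isProbabilityMeasure_weightMeasure {w : α → ℝ} (hw : ∀ a, 0 ≤ w a) (hw1 : ∑ a, w a = 1) :
    IsProbabilityMeasure (weightMeasure w) := by
  classical
  refine ⟨?_⟩
  have h : (weightMeasure w).real univ = 1 := by
    rw [measureReal_eq_sum_filter (weightMeasure w) univ, Finset.filter_true_of_mem fun x _ => mem_univ x, ← hw1]
    exact Finset.sum_congr rfl fun a _ => weightMeasure_real_singleton_eq hw a
  rw [measureReal_def] at h
  exact (ENNReal.toReal_eq_one_iff _).1 h

variable {n : ℕ}

/-- **Sahi positivity of all box-TP₂ laws on `{0,1}^ℕ` gives Sahi positivity of every non-degenerate coin-tossing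
weight on `{0,1}^m`** (pad the product law by `false`; a monotone `f` on `{0,1}^m` is the restriction of the monotone
`f ∘ finRestrict m`). [this work] -/
theorem sahiPositive_coinWeight_of_spins
    (h : ∀ μ : Measure (ℕ → Bool), IsProbabilityMeasure μ → IsBoxTP2 μ →
      ∀ f : Fin n → (ℕ → Bool) → ℝ, (∀ i, Measurable (f i)) → (∀ i u, 0 ≤ f i u) → (∀ i, Monotone (f i)) →
        0 ≤ msahiE μ n f)
    (m : ℕ) (q : Fin m → ℝ) (hq : ∀ i, 0 < q i ∧ q i < 1) : SahiPositive (coinWeight q) n := by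
  classical
  intro g hg0 hgmono
  have hw : IsFKGMeasure (coinWeight q) := isFKGMeasure_coinWeight fun i => ⟨(hq i).1.le, (hq i).2.le⟩
  set ν : Measure (Fin m → Bool) := weightMeasure (coinWeight q) with hν
  haveI : IsProbabilityMeasure ν := isProbabilityMeasure_weightMeasure hw.nonneg hw.sum_eq_one
  have hνbox : IsBoxTP2 ν :=
    isBoxTP2_of_latticeCondition_singleton ν fun a b => by
      simp only [hν, weightMeasure_real_singleton_eq hw.nonneg]
      exact hw.mul_le_mul a b
  set ext : (Fin m → Bool) → (ℕ → Bool) := fun x => finExtend m x (⊥ : Bool) with hext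
  haveI : IsProbabilityMeasure (ν.map ext) := Measure.isProbabilityMeasure_map (measurable_finExtend_bot m).aemeasurable
  have hmp : MeasurePreserving ext ν (ν.map ext) := ⟨measurable_finExtend_bot m, rfl⟩
  have key := h (ν.map ext) inferInstance (hνbox.map_finExtend_bot measurableSet_Icc_spins)
    (fun i => g i ∘ finRestrict m) (fun i => Measurable.of_discrete.comp (measurable_finRestrict m))
    (fun i u => hg0 i _) fun i u v huv => hgmono i (finRestrict_mono m huv)
  rw [← msahiE_comp_measurePreserving_of_measurable hmp n _
    fun i => Measurable.of_discrete.comp (measurable_finRestrict m)] at key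
  have e : (fun i => (g i ∘ finRestrict m) ∘ ext) = g := by
    funext i x
    simp only [Function.comp_apply, hext, finRestrict_finExtend]
  rwa [e, hν, msahiE_weightMeasure hw.nonneg] at key

/-- **SAHI'S CONJECTURE `C_n` ⟺ every box-TP₂ probability measure on `{0,1}^ℕ` is Sahi-positive of order `n`**
for all measurable nonnegative monotone families. [this work; cite: Sahi2008, Conj. 5 (p. 212); Kahn2022, p. 2 fn. 1] -/
theorem sahiConjecture_iff_forall_isBoxTP2_spins (n : ℕ) :
    SahiConjecture n ↔ ∀ μ : Measure (ℕ → Bool), IsProbabilityMeasure μ → IsBoxTP2 μ →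
      ∀ f : Fin n → (ℕ → Bool) → ℝ, (∀ i, Measurable (f i)) → (∀ i u, 0 ≤ f i u) → (∀ i, Monotone (f i)) →
        0 ≤ msahiE μ n f := by
  refine ⟨fun hC μ hμP hμ f hfm hf0 hmono => ?_, fun h => ?_⟩
  · haveI := hμP
    exact msahiE_nonneg_of_isBoxTP2_spins ((sahiConjecture_iff_forall_liebSahiContinuum n).1 hC) μ hμ f hfm hf0 hmono
  · intro α _ _ μ hμ
    exact SahiPositive.of_isFKGMeasure_of_forall_coinWeight (fun m q hq => sahiPositive_coinWeight_of_spins h m q hq) hμ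

/-- **`C_n` ⟺ every probability measure on `{0,1}^ℕ` with FKG-lattice cylinder probabilities is Sahi-positive of
order `n`.** [this work] -/
theorem sahiConjecture_iff_forall_fkg_marginals (n : ℕ) :
    SahiConjecture n ↔ ∀ μ : Measure (ℕ → Bool), IsProbabilityMeasure μ →
      (∀ (d : ℕ) (x y : Fin d → Bool),
        μ.real {u | finRestrict d u = x} * μ.real {u | finRestrict d u = y} ≤
          μ.real {u | finRestrict d u = x ⊓ y} * μ.real {u | finRestrict d u = x ⊔ y}) →
      ∀ f : Fin n → (ℕ → Bool) → ℝ, (∀ i, Measurable (f i)) → (∀ i u, 0 ≤ f i u) → (∀ i, Monotone (f i)) →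
        0 ≤ msahiE μ n f := by
  rw [sahiConjecture_iff_forall_isBoxTP2_spins]
  refine ⟨fun h μ hμP hfkg => h μ hμP (isBoxTP2_of_fkg_marginals μ hfkg), fun h μ hμP hμ => ?_⟩
  haveI := hμP
  exact h μ hμP ((isBoxTP2_iff_fkg_marginals μ).1 hμ)

end Coins

end Summit.CriticalPhenomena.PercolationContinuityZ3.Theorems.SahiBoxTP2
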